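import Mathlib
import Summits.Ventures.PercRepro2.CrossAPrimeA1VMid

/-!
# The `a₂–v` edge is free: `(1 − q)²·crossA′so(p[e ↦ 0]) ≤ crossA′so(p)` for `e = {a₂, v}`
(blind cell PercRepro2, p5 g32; `proofs/P5-OEDGE.md` §42 (17), S4 §2.4 (s) addendum 21 (17))

With `e = {a₂, v}` open, `v ∈ C(a₂)`, so on `Q = {a₂ ↮ a₁}` the `vL`-masses vanish
(`prob_update_one_Q_vL_eq_zero`), while `π₁ = P_{p[e ↦ 1]}(vL) ≥ π₀` (`prob_vL_update_mono`).
The tool for the remaining cross terms is `P(Q, vL, oH) ≤ π₀·P(Q, oH)` (**`prob_Q_vL_oH_le`**):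
BHK 1.4 under the avoidance of `a₁` (`bhk_vL_avoid_single`, the decreasing functional `1 − g_v`
against the increasing `C(a₂)`-event `oH`) and Harris. Then `E₁ = 3B₁ − B₀ ≥ 2Z₁D₀ + (π₁ − π₀)x₀y₀`,
`3B₂ ≥ 0`, `B₃ = π₁x₁y₁ ≥ 0`, and the one-edge cubic gives the reduction
(**`crossA'so_a2v_edge`**). Together with `crossA'so_root_edge` (`a₁–a₂`) and `crossA'so_a1v_edge`
(`a₁–v`) the three edges among `{a₁, a₂, v}` are free. Own work; standard axioms.
-/

namespace Summit.Ventures.PercRepro2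

open LeafRowPendantRootSO CrossAPrimeA1V CrossAPrimeA1VMid

namespace CrossAPrimeA2V

section Tools

variable {V : Type*} {E : Type*} [Fintype E] [DecidableEq E] [Fintype V] [DecidableEq V]
  {R : Type*} [Field R] [LinearOrder R] [IsStrictOrderedRing R]
variable {ends : E → Sym2 V}

omit [Fintype E] [DecidableEq E] [Fintype V] [DecidableEq V] [LinearOrder R]
  [IsStrictOrderedRing R] in
/-- `Q = {a₂ ↮ a₁}` is a decreasing event. -/
lemma isLowerSet_Q (a₁ a₂ : V) : IsLowerSet (avoidAll ends a₂ {a₁}) :=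
  fun _ _ h hω y hy hc => hω y hy (conn_mono h hc)

omit [Fintype V] [DecidableEq V] [LinearOrder R] [IsStrictOrderedRing R] in
/-- The outside probability of `a₁` vanishes on `a₁`-containing clusters, so the avoidance of
`{a₁}` can be dropped under it. -/
lemma outside_mul_avoid_singleton (p : E → R) (a₁ a₂ : V) (𝓥 : Set (Set V)) (ω : Config E) :
    outsideProb p ends a₁ 𝓥 (cluster ends ω a₂) * (avoidAll ends a₂ {a₁}).indicator 1 ω =
      outsideProb p ends a₁ 𝓥 (cluster ends ω a₂) * (avoidAll ends a₂ (∅ : Finset V)).indicator 1 ω := by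
  by_cases h1 : a₁ ∈ cluster ends ω a₂
  · rw [outsideProb_apply_of_mem p 𝓥 h1, zero_mul, zero_mul]
  · have hω : ω ∈ avoidAll ends a₂ {a₁} := by
      rw [mem_avoidAll]
      intro x hx
      rw [Finset.mem_singleton] at hx
      subst hx
      exact h1
    have hω' : ω ∈ avoidAll ends a₂ (∅ : Finset V) := by
      rw [mem_avoidAll]
      intro x hx
      exact absurd hx (Finset.notMem_empty x)
    rw [Set.indicator_of_mem hω, Set.indicator_of_mem hω']

/-- **BHK 1.4 under the avoidance of `a₁`**: `P(Q, vL, oH)·P(Q) ≤ P(Q, oH)·P(Q, vL)`. -/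
theorem bhk_vL_avoid_single (p : E → R) (hp : IsProbVec p) (a₁ a₂ v o : V) :
    prob p (avoidAll ends a₂ {a₁} ∩ (connEvent ends a₁ v ∩ connEvent ends a₂ o)) *
        prob p (avoidAll ends a₂ {a₁}) ≤
      prob p (avoidAll ends a₂ {a₁} ∩ connEvent ends a₂ o) *
        prob p (avoidAll ends a₂ {a₁} ∩ connEvent ends a₁ v) := by
  classical
  set 𝓤 : Set (Set V) := {W | o ∈ W} with h𝓤
  set 𝓥 : Set (Set V) := {W | v ∈ W} with h𝓥
  have hU : IsUpperSet 𝓤 := fun _ _ hWW' ho => hWW' ho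
  have hV : IsUpperSet 𝓥 := fun _ _ hWW' hv => hWW' hv
  have hF₁ : Monotone (𝓤.indicator (1 : Set V → R)) := monotone_indicator_one_of_isUpperSet hU
  have hF₂ : Monotone (fun W => 1 - outsideProb p ends a₁ 𝓥 W) := fun W W' h => by
    have := outsideProb_anti hp ends a₁ hV h
    simp only
    linarith
  have hF₁0 : ∀ W, 0 ≤ 𝓤.indicator (1 : Set V → R) W :=
    fun W => Set.indicator_apply_nonneg fun _ => zero_le_one
  have hF₂0 : ∀ W, 0 ≤ 1 - outsideProb p ends a₁ 𝓥 W :=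
    fun W => sub_nonneg.2 (outsideProb_le_one hp ends a₁ 𝓥 W)
  have key := bhk_univ_avoid p hp ends a₂ {a₁} hF₁ hF₂ hF₁0 hF₂0
  have hins : (insert a₁ (∅ : Finset V)) = {a₁} := Finset.insert_empty
  have e1 : expect p (fun ω => 𝓤.indicator (1 : Set V → R) (cluster ends ω a₂) *
      (avoidAll ends a₂ {a₁}).indicator 1 ω) =
      prob p (avoidAll ends a₂ {a₁} ∩ connEvent ends a₂ o) := by
    rw [← prob_clusterInEvent_inter_eq_expect, Set.inter_comm, clusterInEvent_mem_eq]
  have eg : expect p (fun ω => outsideProb p ends a₁ 𝓥 (cluster ends ω a₂) *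
      (avoidAll ends a₂ {a₁}).indicator 1 ω) =
      prob p (avoidAll ends a₂ {a₁} ∩ connEvent ends a₁ v) := by
    simp only [outside_mul_avoid_singleton p a₁ a₂ 𝓥]
    rw [← prob_outside_inter_avoid_eq_expect p ends a₂ a₁ ∅ 𝓥, hins, h𝓥, clusterInEvent_mem_eq,
      Set.inter_comm]
  have eug : expect p (fun ω => 𝓤.indicator (1 : Set V → R) (cluster ends ω a₂) *
      outsideProb p ends a₁ 𝓥 (cluster ends ω a₂) * (avoidAll ends a₂ {a₁}).indicator 1 ω) =
      prob p (avoidAll ends a₂ {a₁} ∩ (connEvent ends a₁ v ∩ connEvent ends a₂ o)) := by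
    have : (fun ω => 𝓤.indicator (1 : Set V → R) (cluster ends ω a₂) *
        outsideProb p ends a₁ 𝓥 (cluster ends ω a₂) * (avoidAll ends a₂ {a₁}).indicator 1 ω) =
        fun ω => 𝓤.indicator (1 : Set V → R) (cluster ends ω a₂) *
        outsideProb p ends a₁ 𝓥 (cluster ends ω a₂) *
        (avoidAll ends a₂ (∅ : Finset V)).indicator 1 ω := by
      funext ω
      rw [mul_assoc, outside_mul_avoid_singleton p a₁ a₂ 𝓥, ← mul_assoc]
    rw [this, ← prob_clusterIn_outside_inter_avoid_eq_expect p ends a₂ a₁ ∅ 𝓤 𝓥, hins, h𝓤, h𝓥,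
      clusterInEvent_mem_eq, clusterInEvent_mem_eq]
    congr 1
    ext ω
    simp only [Set.mem_inter_iff]
    tauto
  have eZ : expect p (fun ω => (avoidAll ends a₂ {a₁}).indicator 1 ω) =
      prob p (avoidAll ends a₂ {a₁}) := (prob_eq_expect_indicator p _).symm
  have l2 : expect p (fun ω => (1 - outsideProb p ends a₁ 𝓥 (cluster ends ω a₂)) *
      (avoidAll ends a₂ {a₁}).indicator 1 ω) =
      prob p (avoidAll ends a₂ {a₁}) - prob p (avoidAll ends a₂ {a₁} ∩ connEvent ends a₁ v) := by
    rw [← eZ, ← eg, ← expect_sub]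
    unfold expect
    refine Finset.sum_congr rfl fun ω _ => ?_
    simp only [Pi.sub_apply]
    ring
  have l3 : expect p (fun ω => 𝓤.indicator (1 : Set V → R) (cluster ends ω a₂) *
      (1 - outsideProb p ends a₁ 𝓥 (cluster ends ω a₂)) *
      (avoidAll ends a₂ {a₁}).indicator 1 ω) =
      prob p (avoidAll ends a₂ {a₁} ∩ connEvent ends a₂ o) -
        prob p (avoidAll ends a₂ {a₁} ∩ (connEvent ends a₁ v ∩ connEvent ends a₂ o)) := by
    rw [← e1, ← eug, ← expect_sub]
    unfold expect
    refine Finset.sum_congr rfl fun ω _ => ?_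
    simp only [Pi.sub_apply]
    ring
  rw [e1, l2, l3] at key
  nlinarith [key]

/-- **`P(Q, vL, oH) ≤ π₀·P(Q, oH)`** (BHK 1.4 under the avoidance of `a₁` and Harris). -/
theorem prob_Q_vL_oH_le (p : E → R) (hp : IsProbVec p) (a₁ a₂ v o : V) :
    prob p (avoidAll ends a₂ {a₁} ∩ (connEvent ends a₁ v ∩ connEvent ends a₂ o)) ≤
      prob p (connEvent ends a₁ v) * prob p (avoidAll ends a₂ {a₁} ∩ connEvent ends a₂ o) := by
  have h1 := bhk_vL_avoid_single (ends := ends) p hp a₁ a₂ v o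
  have h2 : prob p (avoidAll ends a₂ {a₁} ∩ connEvent ends a₁ v) ≤
      prob p (avoidAll ends a₂ {a₁}) * prob p (connEvent ends a₁ v) :=
    prob_inter_le_prob_mul_prob_of_isLowerSet hp (isLowerSet_Q a₁ a₂) (isUpperSet_connEvent ends a₁ v)
  have hZ0 := prob_nonneg hp (avoidAll ends a₂ {a₁})
  have hx0 := prob_nonneg hp (avoidAll ends a₂ {a₁} ∩ connEvent ends a₂ o)
  have hxv0 := prob_nonneg hp (avoidAll ends a₂ {a₁} ∩ (connEvent ends a₁ v ∩ connEvent ends a₂ o))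
  have hxvZ : prob p (avoidAll ends a₂ {a₁} ∩ (connEvent ends a₁ v ∩ connEvent ends a₂ o)) ≤
      prob p (avoidAll ends a₂ {a₁}) := prob_mono hp Set.inter_subset_left
  rcases eq_or_lt_of_le hZ0 with hZ | hZ
  · have : prob p (avoidAll ends a₂ {a₁} ∩ (connEvent ends a₁ v ∩ connEvent ends a₂ o)) = 0 :=
      le_antisymm (by rw [← hZ] at hxvZ; exact hxvZ) hxv0
    rw [this]
    exact mul_nonneg (prob_nonneg hp _) hx0
  · have := mul_le_mul_of_nonneg_left h2 hx0
    exact le_of_mul_le_mul_right (by nlinarith) hZ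

end Tools

section Edge

variable {V : Type*} {E : Type*} [Fintype E] [DecidableEq E] [Fintype V] [DecidableEq V]
  {R : Type*} [Field R] [LinearOrder R] [IsStrictOrderedRing R]
variable {ends : E → Sym2 V} {e : E} {a₂ v : V}

omit [Fintype V] [DecidableEq V] [LinearOrder R] [IsStrictOrderedRing R] in
/-- With `e = {a₂, v}` open, `Q ∩ vL` is impossible: the `vL`-masses on `Q` vanish. -/
lemma prob_update_one_Q_vL_eq_zero (p : E → R) (he : ends e = s(a₂, v)) (a₁ : V)
    (X : Set (Config E)) :
    prob (Function.update p e 1) (avoidAll ends a₂ {a₁} ∩ (connEvent ends a₁ v ∩ X)) = 0 := by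
  rw [← prob_update_one_inter_openEdge]
  have : avoidAll ends a₂ {a₁} ∩ (connEvent ends a₁ v ∩ X) ∩ openEdge e = ∅ := by
    ext ω
    simp only [Set.mem_empty_iff_false, iff_false]
    rintro ⟨⟨hQ, hv, _⟩, hωe⟩
    exact (mem_avoidAll.1 hQ) a₁ (Finset.mem_singleton_self a₁)
      (conn_trans (conn_of_openAdj ⟨e, hωe, he⟩) (conn_symm hv))
  rw [this, prob_empty]

omit [Fintype V] [DecidableEq V] in
/-- Opening an edge can only help `vL`: `P_{p[e ↦ 0]}(vL) ≤ P_{p[e ↦ 1]}(vL)`. -/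
lemma prob_vL_update_mono {p : E → R} (hp : IsProbVec p) (e : E) (a₁ v : V) :
    prob (Function.update p e 0) (connEvent ends a₁ v) ≤
      prob (Function.update p e 1) (connEvent ends a₁ v) := by
  rw [RBRootEdge.prob_update_zero_eq, RBRootEdge.prob_update_one_eq]
  apply prob_mono hp
  intro ω hω
  simp only [Set.mem_setOf_eq] at hω ⊢
  refine isUpperSet_connEvent ends a₁ v ?_ hω
  intro f
  by_cases hf : f = e
  · subst hf
    simp
  · simp [Function.update_of_ne hf]

omit [Fintype V] [DecidableEq V] [LinearOrder R] [IsStrictOrderedRing R] in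
/-- A pattern with the middle copy at `p[e ↦ 1]` reduces to its `π`-term. -/
lemma crossPat_mid_one (p : E → R) (he : ends e = s(a₂, v)) (pa pc : E → R) (o a₁ b : V) :
    crossPat pa (Function.update p e 1) pc ends o a₁ a₂ v b =
      prob pc (connEvent ends a₁ v) * prob pa (avoidAll ends a₂ {a₁} ∩ connEvent ends a₂ o) *
        prob (Function.update p e 1) (avoidAll ends a₂ {a₁} ∩ connEvent ends a₂ b) := by
  unfold crossPat
  rw [prob_update_one_Q_vL_eq_zero p he, prob_update_one_Q_vL_eq_zero p he,
    prob_update_one_Q_vL_eq_zero p he]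
  ring

/-- `E₁ ≥ 0` along `e = {a₂, v}`: `crossA′so(p[e ↦ 0]) ≤ Φ₁₀₀ + Φ₀₁₀ + Φ₀₀₁`. -/
theorem E1_nonneg_a2v {p : E → R} (hp : IsProbVec p) (he : ends e = s(a₂, v)) (o a₁ b : V) :
    crossA'so (Function.update p e 0) ends o a₁ a₂ v b ≤
      crossPat (Function.update p e 1) (Function.update p e 0) (Function.update p e 0)
          ends o a₁ a₂ v b +
        crossPat (Function.update p e 0) (Function.update p e 1) (Function.update p e 0)
          ends o a₁ a₂ v b +
        crossPat (Function.update p e 0) (Function.update p e 0) (Function.update p e 1)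
          ends o a₁ a₂ v b := by
  have hp0 : IsProbVec (Function.update p e 0) := hp.update e le_rfl zero_le_one
  have hp1 : IsProbVec (Function.update p e 1) := hp.update e zero_le_one le_rfl
  rw [crossA'so_eq_crossPat, crossPat_mid_one p he]
  unfold crossPat
  have hu₁ := prob_Q_vL_oH_le (ends := ends) (Function.update p e 0) hp0 a₁ a₂ v o
  have hu₂ := prob_Q_vL_oH_le (ends := ends) (Function.update p e 0) hp0 a₁ a₂ v b
  have hππ := prob_vL_update_mono (ends := ends) hp e a₁ v
  have t1 := mul_le_mul_of_nonneg_left hu₁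
    (prob_nonneg hp1 (avoidAll ends a₂ {a₁} ∩ connEvent ends a₂ b))
  have t2 := mul_le_mul_of_nonneg_left hu₂
    (prob_nonneg hp1 (avoidAll ends a₂ {a₁} ∩ connEvent ends a₂ o))
  have t3 := mul_nonneg (mul_nonneg (sub_nonneg.2 hππ)
    (prob_nonneg hp0 (avoidAll ends a₂ {a₁} ∩ connEvent ends a₂ o)))
    (prob_nonneg hp0 (avoidAll ends a₂ {a₁} ∩ connEvent ends a₂ b))
  have t4 := mul_nonneg (prob_nonneg hp1 (avoidAll ends a₂ {a₁}))
    (prob_nonneg hp0 (avoidAll ends a₂ {a₁} ∩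
      (connEvent ends a₁ v ∩ (connEvent ends a₂ o ∩ connEvent ends a₂ b))))
  nlinarith [t1, t2, t3, t4]

/-- `B₂ ≥ 0` along `e = {a₂, v}`. -/
theorem B2_nonneg_a2v {p : E → R} (hp : IsProbVec p) (he : ends e = s(a₂, v)) (o a₁ b : V) :
    0 ≤ crossPat (Function.update p e 1) (Function.update p e 1) (Function.update p e 0)
          ends o a₁ a₂ v b +
        crossPat (Function.update p e 1) (Function.update p e 0) (Function.update p e 1)
          ends o a₁ a₂ v b +
        crossPat (Function.update p e 0) (Function.update p e 1) (Function.update p e 1)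
          ends o a₁ a₂ v b := by
  have hp0 : IsProbVec (Function.update p e 0) := hp.update e le_rfl zero_le_one
  have hp1 : IsProbVec (Function.update p e 1) := hp.update e zero_le_one le_rfl
  rw [crossPat_mid_one p he, crossPat_mid_one p he]
  unfold crossPat
  have hu₁ := prob_Q_vL_oH_le (ends := ends) (Function.update p e 0) hp0 a₁ a₂ v o
  have hu₂ := prob_Q_vL_oH_le (ends := ends) (Function.update p e 0) hp0 a₁ a₂ v b
  have hππ := prob_vL_update_mono (ends := ends) hp e a₁ v
  have hx₀ := prob_nonneg hp0 (avoidAll ends a₂ {a₁} ∩ connEvent ends a₂ o)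
  have hy₀ := prob_nonneg hp0 (avoidAll ends a₂ {a₁} ∩ connEvent ends a₂ b)
  have hx₁ := prob_nonneg hp1 (avoidAll ends a₂ {a₁} ∩ connEvent ends a₂ o)
  have hy₁ := prob_nonneg hp1 (avoidAll ends a₂ {a₁} ∩ connEvent ends a₂ b)
  have hπ₀ := prob_nonneg hp0 (connEvent ends a₁ v)
  have t1 := mul_le_mul_of_nonneg_left hu₁ hy₁
  have t2 := mul_le_mul_of_nonneg_left hu₂ hx₁
  have t3 := mul_nonneg (mul_nonneg (sub_nonneg.2 hππ) hx₀) hy₁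
  have t4 := mul_nonneg (mul_nonneg (sub_nonneg.2 hππ) hx₁) hy₀
  have t5 := mul_nonneg (prob_nonneg hp1 (avoidAll ends a₂ {a₁}))
    (prob_nonneg hp0 (avoidAll ends a₂ {a₁} ∩
      (connEvent ends a₁ v ∩ (connEvent ends a₂ o ∩ connEvent ends a₂ b))))
  have t6 := mul_nonneg (mul_nonneg hπ₀ hx₁) hy₁
  nlinarith [t1, t2, t3, t4, t5, t6]

omit [Fintype V] [DecidableEq V] in
/-- `B₃ ≥ 0` along `e = {a₂, v}` (no induction needed: `B₃ = π₁x₁y₁`). -/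
theorem B3_nonneg_a2v {p : E → R} (hp : IsProbVec p) (he : ends e = s(a₂, v)) (o a₁ b : V) :
    0 ≤ crossPat (Function.update p e 1) (Function.update p e 1) (Function.update p e 1)
          ends o a₁ a₂ v b := by
  have hp1 : IsProbVec (Function.update p e 1) := hp.update e zero_le_one le_rfl
  rw [crossPat_mid_one p he]
  exact mul_nonneg (mul_nonneg (prob_nonneg hp1 _) (prob_nonneg hp1 _)) (prob_nonneg hp1 _)

/-- **The `a₂–v` edge reduction**: for `e = {a₂, v}` of weight `q`,
`(1 − q)²·crossA′so(p[e ↦ 0]) ≤ crossA′so(p)`. -/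
theorem crossA'so_a2v_edge {p : E → R} (hp : IsProbVec p) (he : ends e = s(a₂, v)) (o a₁ b : V) :
    (1 - p e) ^ 2 * crossA'so (Function.update p e 0) ends o a₁ a₂ v b ≤
      crossA'so p ends o a₁ a₂ v b := by
  rw [crossA'so_pin_cubic p ends e o a₁ a₂ v b, crossA'so_eq_crossPat (Function.update p e 0)]
  have hE := E1_nonneg_a2v hp he o a₁ b
  rw [crossA'so_eq_crossPat] at hE
  have h2 := B2_nonneg_a2v hp he o a₁ b
  have h3 := B3_nonneg_a2v hp he o a₁ b
  have hq0 := hp.nonneg e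
  have hq1 := hp.le_one e
  have c1 : 0 ≤ p e * (1 - p e) ^ 2 := mul_nonneg hq0 (sq_nonneg _)
  have c2 : 0 ≤ p e ^ 2 * (1 - p e) := mul_nonneg (sq_nonneg _) (sub_nonneg.2 hq1)
  have c3 : 0 ≤ p e ^ 3 := pow_nonneg hq0 3
  nlinarith [mul_nonneg c1 (sub_nonneg.2 hE), mul_nonneg c2 h2, mul_nonneg c3 h3]

end Edge

end CrossAPrimeA2V

end Summit.Ventures.PercRepro2
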